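/-
Copyright (c) 2026 the pub-hodgecm-mathlib formalisation cell (harness21).  Prover seat hodgecm-mathlib-A-p12 (g23), 2026-09-01.  «S3-ram» seeding wave (LEAD F0P3a-plan (g12)
T11-62∕T11-75; owner F0P3a-p06 (g15); fold pen F0P3-p02 (g16)): organ «T6-2r ∕ H²-ram» — STUB B₂ of the P-2-ram skeleton (α₂), γ_H-KEYED and in EXPLICIT currency (ref5 (g4) R-279∕R-283).
-/
import Literature.NumberTheory.Rogawski1990.DepthZeroTransferHValuesTypeTwoRamified   -- ★ (this seat) FILE B: the two H-columns as `ν_H`-mass × fixed-coset counts; ⊇ FILE A, ★ p847070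
import Literature.NumberTheory.Rogawski1990.TypeTwoDescentParityRamified              -- ★ p847118 (F0P3a-p02 (g16)): the ONE-CALL descent parity (⊇ ★ p847095, this seat)
import Literature.NumberTheory.Rogawski1990.DepthZeroKappaTransferTypeTwoGSide         -- ★ (this lineage, g22): `valuation_quadratic_bounds_of_entrywise_deep`, `setOf_entrywise_deep_mem_nhds_one` (the 1-deep tube)
import Literature.NumberTheory.Rogawski1990.DepthZeroTransferMatrixIdentityRamified    -- ★ B-p14 (g38): `sub_one_mul_geom_sum_range`, `…_succ` (the `(T, S)` geometric sums of the certificate)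
import Literature.NumberTheory.Automorphic.UnitaryTwoRamifiedTreeAction                -- ★ B-p08 (g28): (W1) `descent_of_mem_unitaryGroupOfForm_antidiag`, `eq_of_sq_eq_sq`
import HarnessLib

/-!
# STUB B₂ discharged, γ_H-keyed, EXPLICIT: on the 1-deep tube, a `G`-regular TYPE-(2) `γ_H` of discriminant depth `2N` at a tame-ramified place has
# `(#Fix(U₂⧸K⁰), #Fix(U₂⧸K♯)) = ((q+1)T, 1 + (q+1)T)` (`N = 2n`, `T = Σ_(k<n) q^k`) ∕ `(2S − 1, 2S)` (`N = 2n+1`, `S = Σ_(k≤n) q^k`), and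
# `Φ^st(γ_H, χ⁰) = ν_H(K_H)·#Fix(U₂⧸K⁰)`, `Φ^st(γ_H, χ♯) = ν_H(K♯ × U₁)·#Fix(U₂⧸K♯)`   (Rogawski 1990 §4.9; Labesse–Langlands 1979 §2 Lemma 2.1)

Topic `NumberTheory/Rogawski1990`; namespace `Literature.NumberTheory.Automorphic.UnitaryGroup`.  THEOREMS ONLY (no definition, no instance, no notation, no named fact, no
`sorry`); kernel lane `--supports stmt-HodgeConjecture-24833`.  Cell `pub/hodgecm-mathlib` (D-0151), crux H413; «S3-ram» seeding wave; seat A-p12 (g23).  This is STUB B₂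
`stub_typeTwo_HSideProfiles_ram` of the P-2-ram skeleton (α₂) v0.4 (6c8f4919) in the form the fold pen (F0P3-p02 (g16), T11-75) and the judge (ref5 (g4) R-279∕R-283: «no `∃ Y`,
one explicit currency») asked for: γ_H-KEYED (no `∃ V`: the tube is the 1-deep token `hdeep` of ★ `setOf_entrywise_deep_mem_nhds_one`, a neighbourhood of `1`), the two H-columns
VALUED in B-p14 (g38)'s certificate currency `(T, S)` (★ `DepthZeroTransferMatrixIdentityRamified` §2–§3: `(m⁰, m♯) = ((q+1)T, 1+(q+1)T)` at depth `2n`, `(2S−1, 2S)` at depth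
`2n+1`), the measure factors left symbolic (`ν_H(K_H)`, `ν_H(K♯ × U₁)`; their ratio `(q+1)∕2` is F0P3a-p04 (g18)'s organ (M2)).  HONEST LABEL: HC_CM is proved only modulo the cell's
2 remaining named inputs (hLiu418 24832, h413 24833) until rung 0 closes; this file is an ASSEMBLY over ★ material and asserts nothing printed.

THE ASSEMBLY.  `u := E₂ γ_H.1 ∈ U(σ_w, antidiag(1,1))` (★ `coe_mem_unitaryGroupOfForm_antidiag_two_of_mem_placeForm`); (W1) descent `diag(1,ϖ)·u·diag(1,ϖ)⁻¹ = s·ι_w(g)` for the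
anti-fixed uniformiser `ϖ` (★ `descent_of_mem_unitaryGroupOfForm_antidiag`); `|2|_v = 1` from `2 ∈ 𝒪_w^×` (`|ι 2|_w = |2|_v²`, ★ `valued_toPlace_eq_sq_of_ramified`); a unit `ε₀ ∈ L⁺_v`
of non-square residue (§1, Mathlib `FiniteField.exists_nonsquare`); the 1-deep tube gives `|tr u − 2|, |det u − 1| ≤ |ϖ|` and `|tr²u − 4det u| ≤ |ϖ|²` (★
`valuation_quadratic_bounds_of_entrywise_deep`), so `N ≥ 1`; ★ p847118's ONE-CALL parity head turns the depth token `|tr²u − 4det u|_w = exp(−2N)` into `tr²g − 4det g = ε₀z²`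
(`N = 2n`) or `π₁z²` (`N = 2n+1`) with `|z∕tr g| = |ϖ_F|ⁿ`; ★ FILE B §3 (= ★ p847070) counts the `K♯`-column, ★ FILE A the `K⁰`-column (`+1`), and ★ FILE B §1–§2 are the values.

* §1 `exists_forall_valuation_sq_sub_eq_one` (a non-square-residue unit of `L⁺_v`), `valued_two_eq_one_of_isUnit_two_of_ramified` (`|2|_v = 1`), `one_le_of_valued_disc_of_entrywise_deep`.
* §2 COUNTS **`natCard_fixedBy_modular_and_selfDual_of_even_depth_ramified`** (`N = 2n`: `#K♯ = 1 + (q+1)T`, `#K⁰ = (q+1)T`),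
  **`natCard_fixedBy_modular_and_selfDual_of_odd_depth_ramified`** (`N = 2n+1`: `#K♯ = 2S`, `#K⁰ = 2S − 1`), `q = #(𝓞_{L⁺} ∕ v)`, as NATURAL NUMBERS.
* §3 VALUES **`stableOrbitalIntegralRel_typeTwo_HSide_of_even_depth_ramified`**, **`…_of_odd_depth_ramified`**: `Φ^st(γ_H, χ♯) = ν_H(C′×U₁)·#K♯` and `Φ^st(γ_H, χ⁰) = ν_H(K_H)·#K⁰`
  with the §2 numbers substituted (END's `χ⁰`, `χ♯` tokens VERBATIM; `C′ ↔ D_ϖ GL₂(𝒪_w) D_ϖ⁻¹` by its `E₂`-dictionary, e.g. `K₂ 1` of ★ `exists_vertexCover_of_ramified`).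

## References
* [Rogawski1990] J. D. Rogawski, *Automorphic Representations of Unitary Groups in Three Variables*, Ann. of Math. Stud. 123 (1990): §4.9 Lemma 4.9.3 p. 56, Prop. 4.9.1 (b) p. 55;
  §3.6 p. 31.
* [LabesseLanglands1979] J.-P. Labesse, R. P. Langlands, *L-indistinguishability for SL(2)*, Canad. J. Math. 31 (1979): §2 Lemma 2.1 p. 8 (the unramified∕ramified elliptic tori:
  vertex ball `1 + (q+1)(qⁿ−1)∕(q−1)`, edge ball `2(q^(n+1)−1)∕(q−1)`).
* [Kottwitz1988] R. E. Kottwitz, *Tamagawa numbers*, Ann. of Math. 127 (1988): §2.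
* [Serre1979] J.-P. Serre, *Local Fields*, GTM 67 (1979): Ch. XIV §4 (units modulo squares of a local field, `p` odd).
-/

set_option autoImplicit false

noncomputable section

open MeasureTheory Measure Set NumberField IsDedekindDomain Matrix ValuativeRel MulAction Finset
open scoped ENNReal NNReal ValuativeRel Matrix MatrixGroups WithZero

namespace Literature.NumberTheory.Automorphic.UnitaryGroup

open Literature.NumberTheory.Rogawski1990 Literature.NumberTheory.Automorphic Literature.NumberTheory.Automorphic.IntegralReduction
open Literature.NumberTheory.Automorphic.HermitianLatticeTree Literature.GroupTheory Literature.NumberTheory.GaloisRepresentations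

/-! ## §1 Local preliminaries at a tame-ramified `w ∣ v` -/

section Prelim

variable (L : Type) [Field L] [NumberField L] [IsCMField L] (v : HeightOneSpectrum (𝓞 ↥(maximalRealSubfield L)))
  (w : PlacesOver L v) (hw : IsCMField.complexConj L • w.1 = w.1)

omit [IsCMField L] in
/-- **A unit of NON-SQUARE residue in `L⁺_v`** (`|2|_v = 1`): `∃ ε₀ ∈ 𝒪_v, ∀ b ∈ 𝒪_v, |b² − ε₀|_v = 1` — lift a non-square of the (finite, odd-characteristic) residue field
(Mathlib `FiniteField.exists_nonsquare`); the `hns` binder of ★ `ncard_setOf_glVertexAct_eq_self_of_unramified_elliptic` ∕ ★ p847118. [cite: Serre1979, Ch. XIV §4] -/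
theorem exists_forall_valuation_sq_sub_eq_one (h2 : Valued.v (2 : (v.adicCompletion ↥(maximalRealSubfield L))) = 1) :
    ∃ ε₀ : (v.adicCompletion ↥(maximalRealSubfield L)), ε₀ ∈ 𝒪[(v.adicCompletion ↥(maximalRealSubfield L))] ∧ ∀ b : (v.adicCompletion ↥(maximalRealSubfield L)), b ∈ 𝒪[(v.adicCompletion ↥(maximalRealSubfield L))] → valuation (v.adicCompletion ↥(maximalRealSubfield L)) (b ^ 2 - ε₀) = 1 := by
  haveI := finite_residueField_integer_adicCompletion L v
  have hchar : ringChar 𝓀[(v.adicCompletion ↥(maximalRealSubfield L))] ≠ 2 := by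
    intro h
    have h2' : red (2 : (v.adicCompletion ↥(maximalRealSubfield L))) ≠ 0 := red_ne_zero_of_valuation_eq_one ((v_eq_one_iff_valuation_eq_one _).1 h2)
    rw [red_two] at h2'
    apply h2'
    have h' : ((ringChar 𝓀[(v.adicCompletion ↥(maximalRealSubfield L))] : ℕ) : 𝓀[(v.adicCompletion ↥(maximalRealSubfield L))]) = 0 := ringChar.Nat.cast_ringChar
    rw [h] at h'
    exact_mod_cast h'
  obtain ⟨a, ha⟩ := FiniteField.exists_nonsquare hchar
  obtain ⟨e, rfl⟩ := IsLocalRing.residue_surjective a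
  refine ⟨(e : (v.adicCompletion ↥(maximalRealSubfield L))), e.2, fun b hb => ?_⟩
  refine valuation_eq_one_of_red_ne_zero (sub_mem (pow_mem hb 2) e.2) fun h0 => ha ?_
  have hcoe : b ^ 2 - (e : (v.adicCompletion ↥(maximalRealSubfield L))) = (((⟨b, hb⟩ : 𝒪[(v.adicCompletion ↥(maximalRealSubfield L))]) ^ 2 - e : 𝒪[(v.adicCompletion ↥(maximalRealSubfield L))]) : (v.adicCompletion ↥(maximalRealSubfield L))) := by push_cast; rfl
  rw [hcoe, red_coe, map_sub, map_pow, sub_eq_zero] at h0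
  exact ⟨IsLocalRing.residue 𝒪[(v.adicCompletion ↥(maximalRealSubfield L))] ⟨b, hb⟩, by rw [← h0, sq]⟩

include hw in
/-- **`|2|_v = 1` from `2 ∈ 𝒪_w^×` at a ramified place** (`|ι_w 2|_w = |2|_v²`, ★ `valued_toPlace_eq_sq_of_ramified`), and `(2 : L⁺_v) ≠ 0`. [cite: Serre1979, Ch. II §2] -/
theorem valued_two_eq_one_of_isUnit_two_of_ramified (he : v.asIdeal.ramificationIdx' w.1.asIdeal ≠ 1) (h2 : IsUnit (2 : 𝒪[(w.1.adicCompletion L)])) :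
    Valued.v (2 : (v.adicCompletion ↥(maximalRealSubfield L))) = 1 ∧ (2 : (v.adicCompletion ↥(maximalRealSubfield L))) ≠ 0 := by
  have h2w : Valued.v (2 : (w.1.adicCompletion L)) = 1 := by
    rw [Valuation.Integers.isUnit_iff_valuation_eq_one (Valuation.integer.integers (ValuativeRel.valuation (w.1.adicCompletion L))),
      (ValuativeRel.isEquiv (ValuativeRel.valuation (w.1.adicCompletion L)) (Valued.v : Valuation (w.1.adicCompletion L) _)).eq_one_iff_eq_one] at h2
    exact h2
  have h : Valued.v (2 : (v.adicCompletion ↥(maximalRealSubfield L))) = 1 := by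
    rw [← map_ofNat (toPlace v w) 2, valued_toPlace_eq_sq_of_ramified L v w hw he] at h2w
    exact eq_of_sq_eq_sq (by rw [h2w, one_pow])
  exact ⟨h, fun h0 => zero_ne_one (by rw [h0, map_zero] at h; exact h)⟩

omit [IsCMField L] in
/-- **`1 ≤ N` ON THE 1-DEEP TUBE**: if `γ_{2,w} ≡ 1 (mod ϖ)` entrywise then `|tr² − 4det|_w ≤ |ϖ|²` (★ `valuation_quadratic_bounds_of_entrywise_deep`), so a depth token `exp(−N′)` has
`2 ≤ N′`; also `|tr − 2|_w < 1` and `|det − 1|_w < 1`. [cite: Rogawski1990, §4.9 p. 55] -/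
theorem valued_trace_det_disc_of_entrywise_deep {ϖ : (w.1.adicCompletion L)} (hϖ : Valued.v ϖ = WithZero.exp (-1 : ℤ)) (g : Matrix (Fin 2) (Fin 2) (w.1.adicCompletion L))
    (hdeep : ∀ i j : Fin 2, Valued.v ((g - 1) i j) ≤ Valued.v ϖ) {N' : ℕ} (hN : Valued.v (g.trace ^ 2 - 4 * g.det) = WithZero.exp (-(N' : ℤ))) :
    Valued.v (g.trace - 2) < 1 ∧ Valued.v (g.det - 1) < 1 ∧ 2 ≤ N' := by
  have hone : Valued.v ((1 : (w.1.adicCompletion L)) - 1) ≤ WithZero.exp (-1 : ℤ) := by rw [sub_self, map_zero]; exact zero_le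
  obtain ⟨-, hdisc, htr, hdet⟩ := valuation_quadratic_bounds_of_entrywise_deep g 1 (fun i j => (hdeep i j).trans hϖ.le) hone
  have hlt : WithZero.exp (-1 : ℤ) < 1 := by rw [← WithZero.exp_zero, WithZero.exp_lt_exp]; norm_num
  refine ⟨htr.trans_lt hlt, hdet.trans_lt hlt, ?_⟩
  rw [hN, WithZero.exp_le_exp] at hdisc
  omega

end Prelim

/-! ## §2 The two fixed-coset COUNTS of a deep type-(2) `γ_H`, by the parity of the discriminant depth -/

section Counts

variable (L : Type) [Field L] [NumberField L] [IsCMField L] (v : HeightOneSpectrum (𝓞 ↥(maximalRealSubfield L)))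
  (w : PlacesOver L v) (hw : IsCMField.complexConj L • w.1 = w.1)

set_option maxHeartbeats 800000 in
include hw in
/-- **DEPTH `2n`: `#Fix_{γ₂}(U₂ ⧸ K♯) = 1 + (q+1)·Σ_(k<n) q^k` and `#Fix_{γ₂}(U₂ ⧸ K⁰) = (q+1)·Σ_(k<n) q^k`** (`q = #(𝓞_{L⁺} ∕ v)`; Labesse–Langlands' vertex ball of radius `n`) for a
`G`-regular type-(2) `γ_H` on the 1-deep tube with `|tr² − 4det|_w(γ_{2,w}) = exp(−2·2n)`, at a tame-ramified place; `C′ ↔ D_ϖ GL₂(𝒪_w) D_ϖ⁻¹`, `K⁰ = U(Φ₂)(𝒪_v)`.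
Assembly: (W1) descent ∘ ★ p847118 (even branch, tree currency) ∘ ★ FILE B §3 ∘ ★ FILE A. [cite: LabesseLanglands1979, §2 Lemma 2.1 p. 8] [cite: Rogawski1990, §4.9 Lemma 4.9.3 p. 56] -/
theorem natCard_fixedBy_modular_and_selfDual_of_even_depth_ramified (he : v.asIdeal.ramificationIdx' w.1.asIdeal ≠ 1) (h2 : IsUnit (2 : 𝒪[(w.1.adicCompletion L)]))
    (ϖ : (w.1.adicCompletion L)ˣ) (hϖ : Valued.v (ϖ : (w.1.adicCompletion L)) = WithZero.exp (-1 : ℤ))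
    (hσϖ : galAdicCompletionMap (L := L) (IsCMField.complexConj L) hw (ϖ : (w.1.adicCompletion L)) = -(ϖ : (w.1.adicCompletion L)))
    (C' : Subgroup ((cmDatum L 2 (Matrix.of fun i j : Fin 2 => if i.val + j.val + 1 = 2 then (1 : L) else 0)).Local v))
    (hC' : ∀ g, g ∈ C' ↔ (((localNonsplitEquiv (IsCMField.complexConj L) (Matrix.of fun i j : Fin 2 => if i.val + j.val + 1 = 2 then (1 : L) else 0) (IsCMField.complexConj_ne_one L) w hw) g : ↥(unitaryGroupOfForm (galAdicCompletionMap (L := L) (IsCMField.complexConj L) hw) (placeForm (Matrix.of fun i j : Fin 2 => if i.val + j.val + 1 = 2 then (1 : L) else 0) w.1))) : GL (Fin 2) (w.1.adicCompletion L)) ∈ (glInt 2 (w.1.adicCompletion L)).map (MulAut.conj (glDiagonal 2 (w.1.adicCompletion L) ![1, ϖ])).toMonoidHom)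
    (hC'o : IsOpen (C' : Set ((cmDatum L 2 (Matrix.of fun i j : Fin 2 => if i.val + j.val + 1 = 2 then (1 : L) else 0)).Local v))) (hC'c : IsCompact (C' : Set ((cmDatum L 2 (Matrix.of fun i j : Fin 2 => if i.val + j.val + 1 = 2 then (1 : L) else 0)).Local v)))
    {γH : ((cmDatum L 2 (Matrix.of fun i j : Fin 2 => if i.val + j.val + 1 = 2 then (1 : L) else 0)).Local v × (cmDatum L 1 (Matrix.of fun i j : Fin 1 => if i.val + j.val + 1 = 1 then (1 : L) else 0)).Local v)} (hreg : IsLocalGRegular L v γH) (hirr : ¬ ∃ x : (w.1.adicCompletion L), ((((γH.1.val : GL (Fin 2) (UnitaryGroup.LocalRing L v)).val.map (Pi.evalRingHom (fun w' : PlacesOver L v => w'.1.adicCompletion L) w))).charpoly).IsRoot x)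
    (hdeep : ∀ i j : Fin 2, Valued.v (((((γH.1.val : GL (Fin 2) (UnitaryGroup.LocalRing L v)).val.map (Pi.evalRingHom (fun w' : PlacesOver L v => w'.1.adicCompletion L) w))) - 1) i j) ≤ Valued.v (ϖ : (w.1.adicCompletion L)))
    {n : ℕ} (hN : Valued.v ((((γH.1.val : GL (Fin 2) (UnitaryGroup.LocalRing L v)).val.map (Pi.evalRingHom (fun w' : PlacesOver L v => w'.1.adicCompletion L) w))).trace ^ 2 - 4 * (((γH.1.val : GL (Fin 2) (UnitaryGroup.LocalRing L v)).val.map (Pi.evalRingHom (fun w' : PlacesOver L v => w'.1.adicCompletion L) w))).det) = WithZero.exp (-((2 * (2 * n) : ℕ) : ℤ))) :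
    Nat.card (fixedBy (((cmDatum L 2 (Matrix.of fun i j : Fin 2 => if i.val + j.val + 1 = 2 then (1 : L) else 0)).Local v) ⧸ C') γH.1) = 1 + (Nat.card (𝓞 ↥(maximalRealSubfield L) ⧸ v.asIdeal) + 1) * ∑ k ∈ Finset.range n, Nat.card (𝓞 ↥(maximalRealSubfield L) ⧸ v.asIdeal) ^ k ∧
      Nat.card (fixedBy (((cmDatum L 2 (Matrix.of fun i j : Fin 2 => if i.val + j.val + 1 = 2 then (1 : L) else 0)).Local v) ⧸ (cmLocalIntegralLevel L 2 (Matrix.of fun i j : Fin 2 => if i.val + j.val + 1 = 2 then (1 : L) else 0) v)) γH.1) = (Nat.card (𝓞 ↥(maximalRealSubfield L) ⧸ v.asIdeal) + 1) * ∑ k ∈ Finset.range n, Nat.card (𝓞 ↥(maximalRealSubfield L) ⧸ v.asIdeal) ^ k := by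
  have hϖ0 : (ϖ : (w.1.adicCompletion L)) ≠ 0 := ϖ.ne_zero
  obtain ⟨h2v, h2v0⟩ := valued_two_eq_one_of_isUnit_two_of_ramified L v w hw he h2
  -- the tube consequences
  have hcoe : ((((localNonsplitEquiv (IsCMField.complexConj L) (Matrix.of fun i j : Fin 2 => if i.val + j.val + 1 = 2 then (1 : L) else 0) (IsCMField.complexConj_ne_one L) w hw) γH.1 : ↥(unitaryGroupOfForm (galAdicCompletionMap (L := L) (IsCMField.complexConj L) hw) (placeForm (Matrix.of fun i j : Fin 2 => if i.val + j.val + 1 = 2 then (1 : L) else 0) w.1))) : GL (Fin 2) (w.1.adicCompletion L)) : Matrix (Fin 2) (Fin 2) (w.1.adicCompletion L)) = (((γH.1.val : GL (Fin 2) (UnitaryGroup.LocalRing L v)).val.map (Pi.evalRingHom (fun w' : PlacesOver L v => w'.1.adicCompletion L) w))) := rfl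
  obtain ⟨htr, -, hN2⟩ := valued_trace_det_disc_of_entrywise_deep L v w hϖ _ hdeep hN
  have hn1 : 1 ≤ n := by omega
  -- the one-place element, its (W1) descent, the non-square unit, the uniformiser downstairs
  have hu := coe_mem_unitaryGroupOfForm_antidiag_two_of_mem_placeForm L w hw ((localNonsplitEquiv (IsCMField.complexConj L) (Matrix.of fun i j : Fin 2 => if i.val + j.val + 1 = 2 then (1 : L) else 0) (IsCMField.complexConj_ne_one L) w hw) γH.1)
  obtain ⟨s, g, hs, hsg⟩ := descent_of_mem_unitaryGroupOfForm_antidiag L v w hw hσϖ hϖ0 _ hu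
  obtain ⟨ε₀, hε₀, hns⟩ := exists_forall_valuation_sq_sub_eq_one L v h2v
  have hϖF := HeckeCharacter.valued_uniformizer (K := ↥(maximalRealSubfield L)) v
  -- ★ p847118, even branch, tree currency
  rw [← hcoe] at hirr hN
  obtain ⟨ht, z, hz, hD, hzn⟩ := descent_trace_ne_zero_and_exists_eq_nonsquare_mul_sq_of_even_of_ramified L v w hw he h2v hu hirr hn1 hN hϖ0
    (g := (g : Matrix (Fin 2) (Fin 2) (v.adicCompletion ↥(maximalRealSubfield L)))) hsg hns hϖF
  rw [hcoe] at hirr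
  -- the `K♯`-column (★ FILE B §3 = ★ p847070) and the `K⁰`-column (★ FILE A)
  have hsharp := sub_one_mul_natCard_fixedBy_add_two_eq_of_unramified_elliptic L v w hw he ϖ hϖ hσϖ hϖF C' hC' γH.1 hs hsg h2v0 hε₀ hns rfl rfl ht hz hD hzn
  have hK2 := isCompact_isOpen_cmLocalIntegralLevel L 2 (Matrix.of fun i j : Fin 2 => if i.val + j.val + 1 = 2 then (1 : L) else 0) v
  haveI := compactSpace_centralizer_cmDatum_two_of_not_exists_isRoot L v w hw (by rw [Matrix.det_fin_two]; simp) γH.1 hirr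
  have hedge := natCard_fixedBy_add_one_eq_natCard_fixedBy_of_deep_of_ramified L v w hw he h2 ϖ hϖ (cmLocalIntegralLevel L 2 (Matrix.of fun i j : Fin 2 => if i.val + j.val + 1 = 2 then (1 : L) else 0) v) C'
    (fun g' => mem_localIntegralLevel_iff_of_smul_eq (IsCMField.complexConj L) 2 (Matrix.of fun i j : Fin 2 => if i.val + j.val + 1 = 2 then (1 : L) else 0) (IsCMField.complexConj_ne_one L) w hw g') hC' hK2.2 hK2.1 hC'o hC'c γH.1
    (isRegularElt_fst_snd_of_isLocalGRegular L v γH hreg).1 htr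
  -- arithmetic: `(q−1)·X + 2 = (q+1)qⁿ` and `(Σ_(k<n) q^k)·(q−1) + 1 = qⁿ` give `X = 1 + (q+1)·Σ`
  have hq2 : 2 ≤ Nat.card (𝓞 ↥(maximalRealSubfield L) ⧸ v.asIdeal) := by
    classical
    haveI : Finite (𝓞 ↥(maximalRealSubfield L) ⧸ v.asIdeal) := Ideal.finiteQuotientOfFreeOfNeBot v.asIdeal v.ne_bot
    haveI : Nontrivial (𝓞 ↥(maximalRealSubfield L) ⧸ v.asIdeal) := Ideal.Quotient.nontrivial_iff.2 v.isPrime.ne_top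
    exact Finite.one_lt_card
  have hgeom : (∑ k ∈ Finset.range n, Nat.card (𝓞 ↥(maximalRealSubfield L) ⧸ v.asIdeal) ^ k) * (Nat.card (𝓞 ↥(maximalRealSubfield L) ⧸ v.asIdeal) - 1) + 1 = Nat.card (𝓞 ↥(maximalRealSubfield L) ⧸ v.asIdeal) ^ n := by
    have h := geom_sum_mul_add (Nat.card (𝓞 ↥(maximalRealSubfield L) ⧸ v.asIdeal) - 1) n
    rwa [Nat.sub_add_cancel (by omega : 1 ≤ Nat.card (𝓞 ↥(maximalRealSubfield L) ⧸ v.asIdeal))] at h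
  have hX : Nat.card (fixedBy (((cmDatum L 2 (Matrix.of fun i j : Fin 2 => if i.val + j.val + 1 = 2 then (1 : L) else 0)).Local v) ⧸ C') γH.1) = 1 + (Nat.card (𝓞 ↥(maximalRealSubfield L) ⧸ v.asIdeal) + 1) * ∑ k ∈ Finset.range n, Nat.card (𝓞 ↥(maximalRealSubfield L) ⧸ v.asIdeal) ^ k := by
    apply Nat.eq_of_mul_eq_mul_left (show 0 < Nat.card (𝓞 ↥(maximalRealSubfield L) ⧸ v.asIdeal) - 1 by omega)
    have key : (Nat.card (𝓞 ↥(maximalRealSubfield L) ⧸ v.asIdeal) - 1) * (1 + (Nat.card (𝓞 ↥(maximalRealSubfield L) ⧸ v.asIdeal) + 1) * ∑ k ∈ Finset.range n, Nat.card (𝓞 ↥(maximalRealSubfield L) ⧸ v.asIdeal) ^ k) + 2 = (Nat.card (𝓞 ↥(maximalRealSubfield L) ⧸ v.asIdeal) + 1) * Nat.card (𝓞 ↥(maximalRealSubfield L) ⧸ v.asIdeal) ^ n := by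
      rw [← hgeom]
      obtain ⟨p, hp⟩ : ∃ p, Nat.card (𝓞 ↥(maximalRealSubfield L) ⧸ v.asIdeal) = p + 1 := ⟨Nat.card (𝓞 ↥(maximalRealSubfield L) ⧸ v.asIdeal) - 1, by omega⟩
      rw [hp, Nat.add_sub_cancel]
      ring
    omega
  exact ⟨hX, by omega⟩

set_option maxHeartbeats 800000 in
include hw in
/-- **DEPTH `2n + 1`: `#Fix_{γ₂}(U₂ ⧸ K♯) = 2·Σ_(k≤n) q^k` and `#Fix_{γ₂}(U₂ ⧸ K⁰) = 2·Σ_(k≤n) q^k − 1`** (Labesse–Langlands' edge ball of radius `n`) for a `G`-regular type-(2) `γ_H` on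
the 1-deep tube with `|tr² − 4det|_w(γ_{2,w}) = exp(−2(2n+1))`, at a tame-ramified place.  Assembly: (W1) descent ∘ ★ p847118 (odd branch) ∘ ★ FILE B §3 ∘ ★ FILE A.
[cite: LabesseLanglands1979, §2 Lemma 2.1 p. 8] [cite: Rogawski1990, §4.9 Lemma 4.9.3 p. 56] -/
theorem natCard_fixedBy_modular_and_selfDual_of_odd_depth_ramified (he : v.asIdeal.ramificationIdx' w.1.asIdeal ≠ 1) (h2 : IsUnit (2 : 𝒪[(w.1.adicCompletion L)]))
    (ϖ : (w.1.adicCompletion L)ˣ) (hϖ : Valued.v (ϖ : (w.1.adicCompletion L)) = WithZero.exp (-1 : ℤ))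
    (hσϖ : galAdicCompletionMap (L := L) (IsCMField.complexConj L) hw (ϖ : (w.1.adicCompletion L)) = -(ϖ : (w.1.adicCompletion L)))
    (C' : Subgroup ((cmDatum L 2 (Matrix.of fun i j : Fin 2 => if i.val + j.val + 1 = 2 then (1 : L) else 0)).Local v))
    (hC' : ∀ g, g ∈ C' ↔ (((localNonsplitEquiv (IsCMField.complexConj L) (Matrix.of fun i j : Fin 2 => if i.val + j.val + 1 = 2 then (1 : L) else 0) (IsCMField.complexConj_ne_one L) w hw) g : ↥(unitaryGroupOfForm (galAdicCompletionMap (L := L) (IsCMField.complexConj L) hw) (placeForm (Matrix.of fun i j : Fin 2 => if i.val + j.val + 1 = 2 then (1 : L) else 0) w.1))) : GL (Fin 2) (w.1.adicCompletion L)) ∈ (glInt 2 (w.1.adicCompletion L)).map (MulAut.conj (glDiagonal 2 (w.1.adicCompletion L) ![1, ϖ])).toMonoidHom)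
    (hC'o : IsOpen (C' : Set ((cmDatum L 2 (Matrix.of fun i j : Fin 2 => if i.val + j.val + 1 = 2 then (1 : L) else 0)).Local v))) (hC'c : IsCompact (C' : Set ((cmDatum L 2 (Matrix.of fun i j : Fin 2 => if i.val + j.val + 1 = 2 then (1 : L) else 0)).Local v)))
    {γH : ((cmDatum L 2 (Matrix.of fun i j : Fin 2 => if i.val + j.val + 1 = 2 then (1 : L) else 0)).Local v × (cmDatum L 1 (Matrix.of fun i j : Fin 1 => if i.val + j.val + 1 = 1 then (1 : L) else 0)).Local v)} (hreg : IsLocalGRegular L v γH) (hirr : ¬ ∃ x : (w.1.adicCompletion L), ((((γH.1.val : GL (Fin 2) (UnitaryGroup.LocalRing L v)).val.map (Pi.evalRingHom (fun w' : PlacesOver L v => w'.1.adicCompletion L) w))).charpoly).IsRoot x)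
    (hdeep : ∀ i j : Fin 2, Valued.v (((((γH.1.val : GL (Fin 2) (UnitaryGroup.LocalRing L v)).val.map (Pi.evalRingHom (fun w' : PlacesOver L v => w'.1.adicCompletion L) w))) - 1) i j) ≤ Valued.v (ϖ : (w.1.adicCompletion L)))
    {n : ℕ} (hN : Valued.v ((((γH.1.val : GL (Fin 2) (UnitaryGroup.LocalRing L v)).val.map (Pi.evalRingHom (fun w' : PlacesOver L v => w'.1.adicCompletion L) w))).trace ^ 2 - 4 * (((γH.1.val : GL (Fin 2) (UnitaryGroup.LocalRing L v)).val.map (Pi.evalRingHom (fun w' : PlacesOver L v => w'.1.adicCompletion L) w))).det) = WithZero.exp (-((2 * (2 * n + 1) : ℕ) : ℤ))) :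
    Nat.card (fixedBy (((cmDatum L 2 (Matrix.of fun i j : Fin 2 => if i.val + j.val + 1 = 2 then (1 : L) else 0)).Local v) ⧸ C') γH.1) = 2 * ∑ k ∈ Finset.range (n + 1), Nat.card (𝓞 ↥(maximalRealSubfield L) ⧸ v.asIdeal) ^ k ∧
      Nat.card (fixedBy (((cmDatum L 2 (Matrix.of fun i j : Fin 2 => if i.val + j.val + 1 = 2 then (1 : L) else 0)).Local v) ⧸ (cmLocalIntegralLevel L 2 (Matrix.of fun i j : Fin 2 => if i.val + j.val + 1 = 2 then (1 : L) else 0) v)) γH.1) + 1 = 2 * ∑ k ∈ Finset.range (n + 1), Nat.card (𝓞 ↥(maximalRealSubfield L) ⧸ v.asIdeal) ^ k := by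
  have hϖ0 : (ϖ : (w.1.adicCompletion L)) ≠ 0 := ϖ.ne_zero
  obtain ⟨h2v, h2v0⟩ := valued_two_eq_one_of_isUnit_two_of_ramified L v w hw he h2
  have hcoe : ((((localNonsplitEquiv (IsCMField.complexConj L) (Matrix.of fun i j : Fin 2 => if i.val + j.val + 1 = 2 then (1 : L) else 0) (IsCMField.complexConj_ne_one L) w hw) γH.1 : ↥(unitaryGroupOfForm (galAdicCompletionMap (L := L) (IsCMField.complexConj L) hw) (placeForm (Matrix.of fun i j : Fin 2 => if i.val + j.val + 1 = 2 then (1 : L) else 0) w.1))) : GL (Fin 2) (w.1.adicCompletion L)) : Matrix (Fin 2) (Fin 2) (w.1.adicCompletion L)) = (((γH.1.val : GL (Fin 2) (UnitaryGroup.LocalRing L v)).val.map (Pi.evalRingHom (fun w' : PlacesOver L v => w'.1.adicCompletion L) w))) := rfl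
  obtain ⟨htr, -, -⟩ := valued_trace_det_disc_of_entrywise_deep L v w hϖ _ hdeep hN
  have hu := coe_mem_unitaryGroupOfForm_antidiag_two_of_mem_placeForm L w hw ((localNonsplitEquiv (IsCMField.complexConj L) (Matrix.of fun i j : Fin 2 => if i.val + j.val + 1 = 2 then (1 : L) else 0) (IsCMField.complexConj_ne_one L) w hw) γH.1)
  obtain ⟨s, g, hs, hsg⟩ := descent_of_mem_unitaryGroupOfForm_antidiag L v w hw hσϖ hϖ0 _ hu
  obtain ⟨ε₀, hε₀, hns⟩ := exists_forall_valuation_sq_sub_eq_one L v h2v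
  have hns' : ∀ b : (v.adicCompletion ↥(maximalRealSubfield L)), Valued.v b ≤ 1 → Valued.v (b ^ 2 - ε₀) = 1 := fun b hb =>
    (v_eq_one_iff_valuation_eq_one _).2 (hns b ((v_le_one_iff_mem_integer b).1 hb))
  have hϖF := HeckeCharacter.valued_uniformizer (K := ↥(maximalRealSubfield L)) v
  -- ★ p847118, odd branch
  rw [← hcoe] at hirr hN
  obtain ⟨ht, hpar⟩ := descent_trace_ne_zero_and_parity_of_mem_unitaryGroupOfForm_of_ramified L v w hw he h2v hu hirr (by omega) hN hϖ0
    (g := (g : Matrix (Fin 2) (Fin 2) (v.adicCompletion ↥(maximalRealSubfield L)))) hsg hns' hϖF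
  rw [hcoe] at hirr
  obtain ⟨n', hn', -⟩ | ⟨n', hn', π₁, z, hπ₁, hz, hD, hzn⟩ := hpar
  · exfalso; omega
  have hnn : n' = n := by omega
  rw [hnn] at hzn
  have hπ₁' : valuation (v.adicCompletion ↥(maximalRealSubfield L)) π₁ = valuation (v.adicCompletion ↥(maximalRealSubfield L)) (HeckeCharacter.uniformizer ↥(maximalRealSubfield L) v : (v.adicCompletion ↥(maximalRealSubfield L))) := (v_eq_iff_valuation_eq _ _).1 hπ₁
  have hzn' : valuation (v.adicCompletion ↥(maximalRealSubfield L)) (z * ((g : Matrix (Fin 2) (Fin 2) (v.adicCompletion ↥(maximalRealSubfield L))).trace)⁻¹) = valuation (v.adicCompletion ↥(maximalRealSubfield L)) (HeckeCharacter.uniformizer ↥(maximalRealSubfield L) v : (v.adicCompletion ↥(maximalRealSubfield L))) ^ n := by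
    rw [← map_pow]
    exact (v_eq_iff_valuation_eq _ _).1 (by rw [map_pow]; exact hzn)
  have hsharp := sub_one_mul_natCard_fixedBy_add_two_eq_of_ramified_elliptic L v w hw he ϖ hϖ hσϖ hϖF C' hC' γH.1 hs hsg h2v0 hπ₁' rfl rfl ht hz hD hzn'
  have hK2 := isCompact_isOpen_cmLocalIntegralLevel L 2 (Matrix.of fun i j : Fin 2 => if i.val + j.val + 1 = 2 then (1 : L) else 0) v
  haveI := compactSpace_centralizer_cmDatum_two_of_not_exists_isRoot L v w hw (by rw [Matrix.det_fin_two]; simp) γH.1 hirr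
  have hedge := natCard_fixedBy_add_one_eq_natCard_fixedBy_of_deep_of_ramified L v w hw he h2 ϖ hϖ (cmLocalIntegralLevel L 2 (Matrix.of fun i j : Fin 2 => if i.val + j.val + 1 = 2 then (1 : L) else 0) v) C'
    (fun g' => mem_localIntegralLevel_iff_of_smul_eq (IsCMField.complexConj L) 2 (Matrix.of fun i j : Fin 2 => if i.val + j.val + 1 = 2 then (1 : L) else 0) (IsCMField.complexConj_ne_one L) w hw g') hC' hK2.2 hK2.1 hC'o hC'c γH.1
    (isRegularElt_fst_snd_of_isLocalGRegular L v γH hreg).1 htr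
  have hq2 : 2 ≤ Nat.card (𝓞 ↥(maximalRealSubfield L) ⧸ v.asIdeal) := by
    classical
    haveI : Finite (𝓞 ↥(maximalRealSubfield L) ⧸ v.asIdeal) := Ideal.finiteQuotientOfFreeOfNeBot v.asIdeal v.ne_bot
    haveI : Nontrivial (𝓞 ↥(maximalRealSubfield L) ⧸ v.asIdeal) := Ideal.Quotient.nontrivial_iff.2 v.isPrime.ne_top
    exact Finite.one_lt_card
  have hgeom : (∑ k ∈ Finset.range (n + 1), Nat.card (𝓞 ↥(maximalRealSubfield L) ⧸ v.asIdeal) ^ k) * (Nat.card (𝓞 ↥(maximalRealSubfield L) ⧸ v.asIdeal) - 1) + 1 = Nat.card (𝓞 ↥(maximalRealSubfield L) ⧸ v.asIdeal) ^ (n + 1) := by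
    have h := geom_sum_mul_add (Nat.card (𝓞 ↥(maximalRealSubfield L) ⧸ v.asIdeal) - 1) (n + 1)
    rwa [Nat.sub_add_cancel (by omega : 1 ≤ Nat.card (𝓞 ↥(maximalRealSubfield L) ⧸ v.asIdeal))] at h
  have hX : Nat.card (fixedBy (((cmDatum L 2 (Matrix.of fun i j : Fin 2 => if i.val + j.val + 1 = 2 then (1 : L) else 0)).Local v) ⧸ C') γH.1) = 2 * ∑ k ∈ Finset.range (n + 1), Nat.card (𝓞 ↥(maximalRealSubfield L) ⧸ v.asIdeal) ^ k := by
    apply Nat.eq_of_mul_eq_mul_left (show 0 < Nat.card (𝓞 ↥(maximalRealSubfield L) ⧸ v.asIdeal) - 1 by omega)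
    have key : (Nat.card (𝓞 ↥(maximalRealSubfield L) ⧸ v.asIdeal) - 1) * (2 * ∑ k ∈ Finset.range (n + 1), Nat.card (𝓞 ↥(maximalRealSubfield L) ⧸ v.asIdeal) ^ k) + 2 = 2 * Nat.card (𝓞 ↥(maximalRealSubfield L) ⧸ v.asIdeal) ^ (n + 1) := by
      rw [← hgeom]; ring
    omega
  exact ⟨hX, by omega⟩

end Counts

/-! ## §3 The two H-VALUES of STUB B₂ on the deep type-(2) population (END's `χ⁰`, `χ♯` tokens) -/

section Values

variable (L : Type) [Field L] [NumberField L] [IsCMField L] (v : HeightOneSpectrum (𝓞 ↥(maximalRealSubfield L)))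
  (w : PlacesOver L v) (hw : IsCMField.complexConj L • w.1 = w.1)

set_option maxHeartbeats 800000 in
include hw in
/-- **STUB B₂ AT DEPTH `2n` (vertex ball)**: `Φ^st(γ_H, χ♯) = ν_H(C′ × U₁)·(1 + (q+1)·Σ_(k<n) q^k)` and `Φ^st(γ_H, χ⁰) = ν_H(K_H)·((q+1)·Σ_(k<n) q^k)` for every `G`-regular TYPE-(2) `γ_H`
on the 1-deep tube with `|tr² − 4det|_w(γ_{2,w}) = exp(−2·2n)` — ★ FILE B §1–§2 with the §2 counts.  `χ♯`, `χ⁰` are END's fold v6 :118 tokens VERBATIM (`ϖ` as a unit; the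
`Decidable` instance of `χ⁰`'s `if` is the binder `χdec`, pass `_`). [cite: Rogawski1990, §4.9 Lemma 4.9.3 p. 56, Prop. 4.9.1 (b) p. 55] [cite: LabesseLanglands1979, §2 Lemma 2.1 p. 8] -/
theorem stableOrbitalIntegralRel_typeTwo_HSide_of_even_depth_ramified (he : v.asIdeal.ramificationIdx' w.1.asIdeal ≠ 1) (h2 : IsUnit (2 : 𝒪[(w.1.adicCompletion L)]))
    (ϖ : (w.1.adicCompletion L)ˣ) (hϖ : Valued.v (ϖ : (w.1.adicCompletion L)) = WithZero.exp (-1 : ℤ))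
    (hσϖ : galAdicCompletionMap (L := L) (IsCMField.complexConj L) hw (ϖ : (w.1.adicCompletion L)) = -(ϖ : (w.1.adicCompletion L)))
    (C' : Subgroup ((cmDatum L 2 (Matrix.of fun i j : Fin 2 => if i.val + j.val + 1 = 2 then (1 : L) else 0)).Local v))
    (hC' : ∀ g, g ∈ C' ↔ (((localNonsplitEquiv (IsCMField.complexConj L) (Matrix.of fun i j : Fin 2 => if i.val + j.val + 1 = 2 then (1 : L) else 0) (IsCMField.complexConj_ne_one L) w hw) g : ↥(unitaryGroupOfForm (galAdicCompletionMap (L := L) (IsCMField.complexConj L) hw) (placeForm (Matrix.of fun i j : Fin 2 => if i.val + j.val + 1 = 2 then (1 : L) else 0) w.1))) : GL (Fin 2) (w.1.adicCompletion L)) ∈ (glInt 2 (w.1.adicCompletion L)).map (MulAut.conj (glDiagonal 2 (w.1.adicCompletion L) ![1, ϖ])).toMonoidHom)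
    (hC'o : IsOpen (C' : Set ((cmDatum L 2 (Matrix.of fun i j : Fin 2 => if i.val + j.val + 1 = 2 then (1 : L) else 0)).Local v))) (hC'c : IsCompact (C' : Set ((cmDatum L 2 (Matrix.of fun i j : Fin 2 => if i.val + j.val + 1 = 2 then (1 : L) else 0)).Local v)))
    [MeasurableSpace ((cmDatum L 2 (Matrix.of fun i j : Fin 2 => if i.val + j.val + 1 = 2 then (1 : L) else 0)).Local v × (cmDatum L 1 (Matrix.of fun i j : Fin 1 => if i.val + j.val + 1 = 1 then (1 : L) else 0)).Local v)] [BorelSpace ((cmDatum L 2 (Matrix.of fun i j : Fin 2 => if i.val + j.val + 1 = 2 then (1 : L) else 0)).Local v × (cmDatum L 1 (Matrix.of fun i j : Fin 1 => if i.val + j.val + 1 = 1 then (1 : L) else 0)).Local v)]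
    [∀ a : ((cmDatum L 2 (Matrix.of fun i j : Fin 2 => if i.val + j.val + 1 = 2 then (1 : L) else 0)).Local v × (cmDatum L 1 (Matrix.of fun i j : Fin 1 => if i.val + j.val + 1 = 1 then (1 : L) else 0)).Local v), MeasurableSpace (((cmDatum L 2 (Matrix.of fun i j : Fin 2 => if i.val + j.val + 1 = 2 then (1 : L) else 0)).Local v × (cmDatum L 1 (Matrix.of fun i j : Fin 1 => if i.val + j.val + 1 = 1 then (1 : L) else 0)).Local v) ⧸ Subgroup.centralizer ({a} : Set ((cmDatum L 2 (Matrix.of fun i j : Fin 2 => if i.val + j.val + 1 = 2 then (1 : L) else 0)).Local v × (cmDatum L 1 (Matrix.of fun i j : Fin 1 => if i.val + j.val + 1 = 1 then (1 : L) else 0)).Local v)))]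
    [∀ a : ((cmDatum L 2 (Matrix.of fun i j : Fin 2 => if i.val + j.val + 1 = 2 then (1 : L) else 0)).Local v × (cmDatum L 1 (Matrix.of fun i j : Fin 1 => if i.val + j.val + 1 = 1 then (1 : L) else 0)).Local v), BorelSpace (((cmDatum L 2 (Matrix.of fun i j : Fin 2 => if i.val + j.val + 1 = 2 then (1 : L) else 0)).Local v × (cmDatum L 1 (Matrix.of fun i j : Fin 1 => if i.val + j.val + 1 = 1 then (1 : L) else 0)).Local v) ⧸ Subgroup.centralizer ({a} : Set ((cmDatum L 2 (Matrix.of fun i j : Fin 2 => if i.val + j.val + 1 = 2 then (1 : L) else 0)).Local v × (cmDatum L 1 (Matrix.of fun i j : Fin 1 => if i.val + j.val + 1 = 1 then (1 : L) else 0)).Local v)))]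
    (νH : Measure ((cmDatum L 2 (Matrix.of fun i j : Fin 2 => if i.val + j.val + 1 = 2 then (1 : L) else 0)).Local v × (cmDatum L 1 (Matrix.of fun i j : Fin 1 => if i.val + j.val + 1 = 1 then (1 : L) else 0)).Local v)) [νH.IsHaarMeasure] [νH.IsMulRightInvariant]
    {mH : OrbitalMeasureFamily ((cmDatum L 2 (Matrix.of fun i j : Fin 2 => if i.val + j.val + 1 = 2 then (1 : L) else 0)).Local v × (cmDatum L 1 (Matrix.of fun i j : Fin 1 => if i.val + j.val + 1 = 1 then (1 : L) else 0)).Local v)} (hmH : mH.IsCanonical (IsLocalGRegular L v) νH)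
    {γH : ((cmDatum L 2 (Matrix.of fun i j : Fin 2 => if i.val + j.val + 1 = 2 then (1 : L) else 0)).Local v × (cmDatum L 1 (Matrix.of fun i j : Fin 1 => if i.val + j.val + 1 = 1 then (1 : L) else 0)).Local v)} (hreg : IsLocalGRegular L v γH) (hirr : ¬ ∃ x : (w.1.adicCompletion L), ((((γH.1.val : GL (Fin 2) (UnitaryGroup.LocalRing L v)).val.map (Pi.evalRingHom (fun w' : PlacesOver L v => w'.1.adicCompletion L) w))).charpoly).IsRoot x)
    (hdeep : ∀ i j : Fin 2, Valued.v (((((γH.1.val : GL (Fin 2) (UnitaryGroup.LocalRing L v)).val.map (Pi.evalRingHom (fun w' : PlacesOver L v => w'.1.adicCompletion L) w))) - 1) i j) ≤ Valued.v (ϖ : (w.1.adicCompletion L)))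
    (χdec : ∀ h : ((cmDatum L 2 (Matrix.of fun i j : Fin 2 => if i.val + j.val + 1 = 2 then (1 : L) else 0)).Local v × (cmDatum L 1 (Matrix.of fun i j : Fin 1 => if i.val + j.val + 1 = 1 then (1 : L) else 0)).Local v), Decidable ((redMat (((h.1.val : GL (Fin 2) (UnitaryGroup.LocalRing L v)).val.map (Pi.evalRingHom (fun w' : PlacesOver L v => w'.1.adicCompletion L) w))) - 1) ^ 2 = 0 ∧ (redMat (((h.1.val : GL (Fin 2) (UnitaryGroup.LocalRing L v)).val.map (Pi.evalRingHom (fun w' : PlacesOver L v => w'.1.adicCompletion L) w))) - 1).rank = 0))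
    {n : ℕ} (hN : Valued.v ((((γH.1.val : GL (Fin 2) (UnitaryGroup.LocalRing L v)).val.map (Pi.evalRingHom (fun w' : PlacesOver L v => w'.1.adicCompletion L) w))).trace ^ 2 - 4 * (((γH.1.val : GL (Fin 2) (UnitaryGroup.LocalRing L v)).val.map (Pi.evalRingHom (fun w' : PlacesOver L v => w'.1.adicCompletion L) w))).det) = WithZero.exp (-((2 * (2 * n) : ℕ) : ℤ))) :
    stableOrbitalIntegralRel (IsLocalStablyConjH L v) mH (Set.indicator {h : ((cmDatum L 2 (Matrix.of fun i j : Fin 2 => if i.val + j.val + 1 = 2 then (1 : L) else 0)).Local v × (cmDatum L 1 (Matrix.of fun i j : Fin 1 => if i.val + j.val + 1 = 1 then (1 : L) else 0)).Local v) | ∀ a b : Fin 2, Valued.v ((ϖ : (w.1.adicCompletion L)) ^ (b : ℕ) * ((ϖ : (w.1.adicCompletion L)) ^ (a : ℕ))⁻¹ * ((((localNonsplitEquiv (IsCMField.complexConj L) (Matrix.of fun i j : Fin 2 => if i.val + j.val + 1 = 2 then (1 : L) else 0) (IsCMField.complexConj_ne_one L) w hw) h.1 : ↥(unitaryGroupOfForm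 (galAdicCompletionMap (L := L) (IsCMField.complexConj L) hw) (placeForm (Matrix.of fun i j : Fin 2 => if i.val + j.val + 1 = 2 then (1 : L) else 0) w.1))) : GL (Fin 2) (w.1.adicCompletion L)) : Matrix (Fin 2) (Fin 2) (w.1.adicCompletion L)) a b) ≤ 1} (fun _ => (1 : ℂ))) γH =
        (νH.real ((C'.prod (⊤ : Subgroup ((cmDatum L 1 (Matrix.of fun i j : Fin 1 => if i.val + j.val + 1 = 1 then (1 : L) else 0)).Local v)) : Subgroup ((cmDatum L 2 (Matrix.of fun i j : Fin 2 => if i.val + j.val + 1 = 2 then (1 : L) else 0)).Local v × (cmDatum L 1 (Matrix.of fun i j : Fin 1 => if i.val + j.val + 1 = 1 then (1 : L) else 0)).Local v)) : Set ((cmDatum L 2 (Matrix.of fun i j : Fin 2 => if i.val + j.val + 1 = 2 then (1 : L) else 0)).Local v × (cmDatum L 1 (Matrix.of fun i j : Fin 1 => if i.val + j.val + 1 = 1 then (1 : L) else 0)).Local v)) : ℂ) * (1 + ((Nat.card (𝓞 ↥(maximalRealSubfield L) ⧸ v.asIdeal) : ℂ) + 1) * ∑ k ∈ Finset.range n, (Nat.card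 (𝓞 ↥(maximalRealSubfield L) ⧸ v.asIdeal) : ℂ) ^ k) ∧
      stableOrbitalIntegralRel (IsLocalStablyConjH L v) mH ((((cmLocalIntegralLevel L 2 (Matrix.of fun i j : Fin 2 => if i.val + j.val + 1 = 2 then (1 : L) else 0) v).prod (cmLocalIntegralLevel L 1 (Matrix.of fun i j : Fin 1 => if i.val + j.val + 1 = 1 then (1 : L) else 0) v) : Subgroup ((cmDatum L 2 (Matrix.of fun i j : Fin 2 => if i.val + j.val + 1 = 2 then (1 : L) else 0)).Local v × (cmDatum L 1 (Matrix.of fun i j : Fin 1 => if i.val + j.val + 1 = 1 then (1 : L) else 0)).Local v)) : Set ((cmDatum L 2 (Matrix.of fun i j : Fin 2 => if i.val + j.val + 1 = 2 then (1 : L) else 0)).Local v × (cmDatum L 1 (Matrix.of fun i j : Fin 1 => if i.val + j.val + 1 = 1 then (1 : L) else 0)).Local v)).indicator (fun h : ((cmDatum L 2 (Matrix.of fun i j : Fin 2 => if i.val + j.val + 1 = 2 then (1 : L) else 0)).Local v × (cmDatum L 1 (Matrix.of fun i j : Fin 1 => if i.val + j.val + 1 = 1 then (1 : L) else 0)).Local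 v) => if (redMat (((h.1.val : GL (Fin 2) (UnitaryGroup.LocalRing L v)).val.map (Pi.evalRingHom (fun w' : PlacesOver L v => w'.1.adicCompletion L) w))) - 1) ^ 2 = 0 ∧ (redMat (((h.1.val : GL (Fin 2) (UnitaryGroup.LocalRing L v)).val.map (Pi.evalRingHom (fun w' : PlacesOver L v => w'.1.adicCompletion L) w))) - 1).rank = 0 then (1 : ℂ) else 0)) γH =
        (νH.real (((cmLocalIntegralLevel L 2 (Matrix.of fun i j : Fin 2 => if i.val + j.val + 1 = 2 then (1 : L) else 0) v).prod (cmLocalIntegralLevel L 1 (Matrix.of fun i j : Fin 1 => if i.val + j.val + 1 = 1 then (1 : L) else 0) v) : Subgroup ((cmDatum L 2 (Matrix.of fun i j : Fin 2 => if i.val + j.val + 1 = 2 then (1 : L) else 0)).Local v × (cmDatum L 1 (Matrix.of fun i j : Fin 1 => if i.val + j.val + 1 = 1 then (1 : L) else 0)).Local v)) : Set ((cmDatum L 2 (Matrix.of fun i j : Fin 2 => if i.val + j.val + 1 = 2 then (1 : L) else 0)).Local v × (cmDatum L 1 (Matrix.of fun i j : Fin 1 => if i.val + j.val + 1 = 1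 then (1 : L) else 0)).Local v)) : ℂ) * (((Nat.card (𝓞 ↥(maximalRealSubfield L) ⧸ v.asIdeal) : ℂ) + 1) * ∑ k ∈ Finset.range n, (Nat.card (𝓞 ↥(maximalRealSubfield L) ⧸ v.asIdeal) : ℂ) ^ k) := by
  obtain ⟨hsharp, hzero⟩ := natCard_fixedBy_modular_and_selfDual_of_even_depth_ramified L v w hw he h2 ϖ hϖ hσϖ C' hC' hC'o hC'c hreg hirr hdeep hN
  obtain ⟨htr, hdet, -⟩ := valued_trace_det_disc_of_entrywise_deep L v w hϖ _ hdeep hN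
  refine ⟨?_, ?_⟩
  · rw [stableOrbitalIntegralRel_indicator_sharp_eq_mul_natCard_fixedBy_of_not_exists_isRoot L v w hw νH hmH ϖ C' hC' hC'o hC'c hreg hirr, hsharp]
    push_cast; ring
  · rw [stableOrbitalIntegralRel_chiZero_eq_mul_natCard_fixedBy_of_not_exists_isRoot_of_deep_ramified L v w hw νH he h2 hmH hreg hirr htr hdet χdec, hzero]
    push_cast; ring

set_option maxHeartbeats 800000 in
include hw in
/-- **STUB B₂ AT DEPTH `2n + 1` (edge ball)**: `Φ^st(γ_H, χ♯) = ν_H(C′ × U₁)·(2·Σ_(k≤n) q^k)` and `Φ^st(γ_H, χ⁰) = ν_H(K_H)·(2·Σ_(k≤n) q^k − 1)` for every `G`-regular TYPE-(2) `γ_H` on the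
1-deep tube with `|tr² − 4det|_w(γ_{2,w}) = exp(−2(2n+1))`. [cite: Rogawski1990, §4.9 Lemma 4.9.3 p. 56, Prop. 4.9.1 (b) p. 55] [cite: LabesseLanglands1979, §2 Lemma 2.1 p. 8] -/
theorem stableOrbitalIntegralRel_typeTwo_HSide_of_odd_depth_ramified (he : v.asIdeal.ramificationIdx' w.1.asIdeal ≠ 1) (h2 : IsUnit (2 : 𝒪[(w.1.adicCompletion L)]))
    (ϖ : (w.1.adicCompletion L)ˣ) (hϖ : Valued.v (ϖ : (w.1.adicCompletion L)) = WithZero.exp (-1 : ℤ))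
    (hσϖ : galAdicCompletionMap (L := L) (IsCMField.complexConj L) hw (ϖ : (w.1.adicCompletion L)) = -(ϖ : (w.1.adicCompletion L)))
    (C' : Subgroup ((cmDatum L 2 (Matrix.of fun i j : Fin 2 => if i.val + j.val + 1 = 2 then (1 : L) else 0)).Local v))
    (hC' : ∀ g, g ∈ C' ↔ (((localNonsplitEquiv (IsCMField.complexConj L) (Matrix.of fun i j : Fin 2 => if i.val + j.val + 1 = 2 then (1 : L) else 0) (IsCMField.complexConj_ne_one L) w hw) g : ↥(unitaryGroupOfForm (galAdicCompletionMap (L := L) (IsCMField.complexConj L) hw) (placeForm (Matrix.of fun i j : Fin 2 => if i.val + j.val + 1 = 2 then (1 : L) else 0) w.1))) : GL (Fin 2) (w.1.adicCompletion L)) ∈ (glInt 2 (w.1.adicCompletion L)).map (MulAut.conj (glDiagonal 2 (w.1.adicCompletion L) ![1, ϖ])).toMonoidHom)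
    (hC'o : IsOpen (C' : Set ((cmDatum L 2 (Matrix.of fun i j : Fin 2 => if i.val + j.val + 1 = 2 then (1 : L) else 0)).Local v))) (hC'c : IsCompact (C' : Set ((cmDatum L 2 (Matrix.of fun i j : Fin 2 => if i.val + j.val + 1 = 2 then (1 : L) else 0)).Local v)))
    [MeasurableSpace ((cmDatum L 2 (Matrix.of fun i j : Fin 2 => if i.val + j.val + 1 = 2 then (1 : L) else 0)).Local v × (cmDatum L 1 (Matrix.of fun i j : Fin 1 => if i.val + j.val + 1 = 1 then (1 : L) else 0)).Local v)] [BorelSpace ((cmDatum L 2 (Matrix.of fun i j : Fin 2 => if i.val + j.val + 1 = 2 then (1 : L) else 0)).Local v × (cmDatum L 1 (Matrix.of fun i j : Fin 1 => if i.val + j.val + 1 = 1 then (1 : L) else 0)).Local v)]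
    [∀ a : ((cmDatum L 2 (Matrix.of fun i j : Fin 2 => if i.val + j.val + 1 = 2 then (1 : L) else 0)).Local v × (cmDatum L 1 (Matrix.of fun i j : Fin 1 => if i.val + j.val + 1 = 1 then (1 : L) else 0)).Local v), MeasurableSpace (((cmDatum L 2 (Matrix.of fun i j : Fin 2 => if i.val + j.val + 1 = 2 then (1 : L) else 0)).Local v × (cmDatum L 1 (Matrix.of fun i j : Fin 1 => if i.val + j.val + 1 = 1 then (1 : L) else 0)).Local v) ⧸ Subgroup.centralizer ({a} : Set ((cmDatum L 2 (Matrix.of fun i j : Fin 2 => if i.val + j.val + 1 = 2 then (1 : L) else 0)).Local v × (cmDatum L 1 (Matrix.of fun i j : Fin 1 => if i.val + j.val + 1 = 1 then (1 : L) else 0)).Local v)))]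
    [∀ a : ((cmDatum L 2 (Matrix.of fun i j : Fin 2 => if i.val + j.val + 1 = 2 then (1 : L) else 0)).Local v × (cmDatum L 1 (Matrix.of fun i j : Fin 1 => if i.val + j.val + 1 = 1 then (1 : L) else 0)).Local v), BorelSpace (((cmDatum L 2 (Matrix.of fun i j : Fin 2 => if i.val + j.val + 1 = 2 then (1 : L) else 0)).Local v × (cmDatum L 1 (Matrix.of fun i j : Fin 1 => if i.val + j.val + 1 = 1 then (1 : L) else 0)).Local v) ⧸ Subgroup.centralizer ({a} : Set ((cmDatum L 2 (Matrix.of fun i j : Fin 2 => if i.val + j.val + 1 = 2 then (1 : L) else 0)).Local v × (cmDatum L 1 (Matrix.of fun i j : Fin 1 => if i.val + j.val + 1 = 1 then (1 : L) else 0)).Local v)))]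
    (νH : Measure ((cmDatum L 2 (Matrix.of fun i j : Fin 2 => if i.val + j.val + 1 = 2 then (1 : L) else 0)).Local v × (cmDatum L 1 (Matrix.of fun i j : Fin 1 => if i.val + j.val + 1 = 1 then (1 : L) else 0)).Local v)) [νH.IsHaarMeasure] [νH.IsMulRightInvariant]
    {mH : OrbitalMeasureFamily ((cmDatum L 2 (Matrix.of fun i j : Fin 2 => if i.val + j.val + 1 = 2 then (1 : L) else 0)).Local v × (cmDatum L 1 (Matrix.of fun i j : Fin 1 => if i.val + j.val + 1 = 1 then (1 : L) else 0)).Local v)} (hmH : mH.IsCanonical (IsLocalGRegular L v) νH)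
    {γH : ((cmDatum L 2 (Matrix.of fun i j : Fin 2 => if i.val + j.val + 1 = 2 then (1 : L) else 0)).Local v × (cmDatum L 1 (Matrix.of fun i j : Fin 1 => if i.val + j.val + 1 = 1 then (1 : L) else 0)).Local v)} (hreg : IsLocalGRegular L v γH) (hirr : ¬ ∃ x : (w.1.adicCompletion L), ((((γH.1.val : GL (Fin 2) (UnitaryGroup.LocalRing L v)).val.map (Pi.evalRingHom (fun w' : PlacesOver L v => w'.1.adicCompletion L) w))).charpoly).IsRoot x)
    (hdeep : ∀ i j : Fin 2, Valued.v (((((γH.1.val : GL (Fin 2) (UnitaryGroup.LocalRing L v)).val.map (Pi.evalRingHom (fun w' : PlacesOver L v => w'.1.adicCompletion L) w))) - 1) i j) ≤ Valued.v (ϖ : (w.1.adicCompletion L)))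
    (χdec : ∀ h : ((cmDatum L 2 (Matrix.of fun i j : Fin 2 => if i.val + j.val + 1 = 2 then (1 : L) else 0)).Local v × (cmDatum L 1 (Matrix.of fun i j : Fin 1 => if i.val + j.val + 1 = 1 then (1 : L) else 0)).Local v), Decidable ((redMat (((h.1.val : GL (Fin 2) (UnitaryGroup.LocalRing L v)).val.map (Pi.evalRingHom (fun w' : PlacesOver L v => w'.1.adicCompletion L) w))) - 1) ^ 2 = 0 ∧ (redMat (((h.1.val : GL (Fin 2) (UnitaryGroup.LocalRing L v)).val.map (Pi.evalRingHom (fun w' : PlacesOver L v => w'.1.adicCompletion L) w))) - 1).rank = 0))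
    {n : ℕ} (hN : Valued.v ((((γH.1.val : GL (Fin 2) (UnitaryGroup.LocalRing L v)).val.map (Pi.evalRingHom (fun w' : PlacesOver L v => w'.1.adicCompletion L) w))).trace ^ 2 - 4 * (((γH.1.val : GL (Fin 2) (UnitaryGroup.LocalRing L v)).val.map (Pi.evalRingHom (fun w' : PlacesOver L v => w'.1.adicCompletion L) w))).det) = WithZero.exp (-((2 * (2 * n + 1) : ℕ) : ℤ))) :
    stableOrbitalIntegralRel (IsLocalStablyConjH L v) mH (Set.indicator {h : ((cmDatum L 2 (Matrix.of fun i j : Fin 2 => if i.val + j.val + 1 = 2 then (1 : L) else 0)).Local v × (cmDatum L 1 (Matrix.of fun i j : Fin 1 => if i.val + j.val + 1 = 1 then (1 : L) else 0)).Local v) | ∀ a b : Fin 2, Valued.v ((ϖ : (w.1.adicCompletion L)) ^ (b : ℕ) * ((ϖ : (w.1.adicCompletion L)) ^ (a : ℕ))⁻¹ * ((((localNonsplitEquiv (IsCMField.complexConj L) (Matrix.of fun i j : Fin 2 => if i.val + j.val + 1 = 2 then (1 : L) else 0) (IsCMField.complexConj_ne_one L) w hw) h.1 : ↥(unitaryGroupOfForm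 (galAdicCompletionMap (L := L) (IsCMField.complexConj L) hw) (placeForm (Matrix.of fun i j : Fin 2 => if i.val + j.val + 1 = 2 then (1 : L) else 0) w.1))) : GL (Fin 2) (w.1.adicCompletion L)) : Matrix (Fin 2) (Fin 2) (w.1.adicCompletion L)) a b) ≤ 1} (fun _ => (1 : ℂ))) γH =
        (νH.real ((C'.prod (⊤ : Subgroup ((cmDatum L 1 (Matrix.of fun i j : Fin 1 => if i.val + j.val + 1 = 1 then (1 : L) else 0)).Local v)) : Subgroup ((cmDatum L 2 (Matrix.of fun i j : Fin 2 => if i.val + j.val + 1 = 2 then (1 : L) else 0)).Local v × (cmDatum L 1 (Matrix.of fun i j : Fin 1 => if i.val + j.val + 1 = 1 then (1 : L) else 0)).Local v)) : Set ((cmDatum L 2 (Matrix.of fun i j : Fin 2 => if i.val + j.val + 1 = 2 then (1 : L) else 0)).Local v × (cmDatum L 1 (Matrix.of fun i j : Fin 1 => if i.val + j.val + 1 = 1 then (1 : L) else 0)).Local v)) : ℂ) * (2 * ∑ k ∈ Finset.range (n + 1), (Nat.card (𝓞 ↥(maximalRealSubfield L) ⧸ v.asIdeal) : ℂ) ^ k)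 ∧
      stableOrbitalIntegralRel (IsLocalStablyConjH L v) mH ((((cmLocalIntegralLevel L 2 (Matrix.of fun i j : Fin 2 => if i.val + j.val + 1 = 2 then (1 : L) else 0) v).prod (cmLocalIntegralLevel L 1 (Matrix.of fun i j : Fin 1 => if i.val + j.val + 1 = 1 then (1 : L) else 0) v) : Subgroup ((cmDatum L 2 (Matrix.of fun i j : Fin 2 => if i.val + j.val + 1 = 2 then (1 : L) else 0)).Local v × (cmDatum L 1 (Matrix.of fun i j : Fin 1 => if i.val + j.val + 1 = 1 then (1 : L) else 0)).Local v)) : Set ((cmDatum L 2 (Matrix.of fun i j : Fin 2 => if i.val + j.val + 1 = 2 then (1 : L) else 0)).Local v × (cmDatum L 1 (Matrix.of fun i j : Fin 1 => if i.val + j.val + 1 = 1 then (1 : L) else 0)).Local v)).indicator (fun h : ((cmDatum L 2 (Matrix.of fun i j : Fin 2 => if i.val + j.val + 1 = 2 then (1 : L) else 0)).Local v × (cmDatum L 1 (Matrix.of fun i j : Fin 1 => if i.val + j.val + 1 = 1 then (1 : L) else 0)).Local v) => if (redMat (((h.1.val : GL (Fin 2) (UnitaryGroup.LocalRing L v)).val.map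 (Pi.evalRingHom (fun w' : PlacesOver L v => w'.1.adicCompletion L) w))) - 1) ^ 2 = 0 ∧ (redMat (((h.1.val : GL (Fin 2) (UnitaryGroup.LocalRing L v)).val.map (Pi.evalRingHom (fun w' : PlacesOver L v => w'.1.adicCompletion L) w))) - 1).rank = 0 then (1 : ℂ) else 0)) γH =
        (νH.real (((cmLocalIntegralLevel L 2 (Matrix.of fun i j : Fin 2 => if i.val + j.val + 1 = 2 then (1 : L) else 0) v).prod (cmLocalIntegralLevel L 1 (Matrix.of fun i j : Fin 1 => if i.val + j.val + 1 = 1 then (1 : L) else 0) v) : Subgroup ((cmDatum L 2 (Matrix.of fun i j : Fin 2 => if i.val + j.val + 1 = 2 then (1 : L) else 0)).Local v × (cmDatum L 1 (Matrix.of fun i j : Fin 1 => if i.val + j.val + 1 = 1 then (1 : L) else 0)).Local v)) : Set ((cmDatum L 2 (Matrix.of fun i j : Fin 2 => if i.val + j.val + 1 = 2 then (1 : L) else 0)).Local v × (cmDatum L 1 (Matrix.of fun i j : Fin 1 => if i.val + j.val + 1 = 1 then (1 : L) else 0)).Local v)) : ℂ) * (2 * (∑ k ∈ Finset.range (n + 1),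 (Nat.card (𝓞 ↥(maximalRealSubfield L) ⧸ v.asIdeal) : ℂ) ^ k) - 1) := by
  obtain ⟨hsharp, hzero⟩ := natCard_fixedBy_modular_and_selfDual_of_odd_depth_ramified L v w hw he h2 ϖ hϖ hσϖ C' hC' hC'o hC'c hreg hirr hdeep hN
  obtain ⟨htr, hdet, -⟩ := valued_trace_det_disc_of_entrywise_deep L v w hϖ _ hdeep hN
  refine ⟨?_, ?_⟩
  · rw [stableOrbitalIntegralRel_indicator_sharp_eq_mul_natCard_fixedBy_of_not_exists_isRoot L v w hw νH hmH ϖ C' hC' hC'o hC'c hreg hirr, hsharp]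
    push_cast; ring
  · rw [stableOrbitalIntegralRel_chiZero_eq_mul_natCard_fixedBy_of_not_exists_isRoot_of_deep_ramified L v w hw νH he h2 hmH hreg hirr htr hdet χdec]
    have hz : (Nat.card (fixedBy (((cmDatum L 2 (Matrix.of fun i j : Fin 2 => if i.val + j.val + 1 = 2 then (1 : L) else 0)).Local v) ⧸ (cmLocalIntegralLevel L 2 (Matrix.of fun i j : Fin 2 => if i.val + j.val + 1 = 2 then (1 : L) else 0) v)) γH.1) : ℂ) = 2 * (∑ k ∈ Finset.range (n + 1), ((Nat.card (𝓞 ↥(maximalRealSubfield L) ⧸ v.asIdeal) : ℕ) : ℂ) ^ k) - 1 := by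
      rw [eq_sub_iff_add_eq]; exact_mod_cast hzero
    rw [hz]

end Values

end Literature.NumberTheory.Automorphic.UnitaryGroup

end
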